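import Summits.SmoothPoincare4.SmoothPoincare4.Theorems.DottedCircleRasmussenDcrGapHelperFriendsCarrierTkAux14

/-!
# Helper `helper_friendsCarrier_Tk_endClosed` of stub `helper_friendsCarrier_Tk` — the end collar, part 8: heights and the closedness clause
(item stmt-SmoothPoincare4-16128, route route-SmoothPoincare4-DottedCircleRasmussen)

Continuation of `…TkAux8–14` (end collar, parts 1–7), porting the sections *The size function
`N = e^{-σ}` of the collar and its lower bounds near the core* and the first end clause of the tree's
`OpenTraceCollar.lean`: at a point `incl y` off the core `e^{-σ} ≥ ξ(α)` (`α = E(G_k y - 1)` the handle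
radius), at a handle-chart point `inr (x, w'')` off the core `e^{-σ} ≥ ψ(log (2/‖univBall w''‖))`; hence
**`c(Y × [a, ∞))` is closed in `T`** (the height `σ → -∞` exactly at the core: its complement is the
union of `c(Y × (-∞, a))`, a neighbourhood `incl {G_k < 1 + s(αof e^{-a})}` of `incl(D_k)` and a
neighbourhood of the core disc in the handle chart).

* `ξ_le_exp_neg_collarInv_incl`, `ψ_le_exp_neg_collarInv_inr`, `isClosed_image_collar_ge`;
* `helper_friendsCarrier_Tk_endClosed` — the registered summary.

Everything is proved; no named facts, no `sorry`.
References: Kirby (1989), Ch. I §5 [Kirby1989]; the tree's `OpenTraceCollar.lean`, `TraceCollarProfile.lean`.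
-/

-- the prescribed namespace `Summit.<P>.<Sub>.…` duplicates `SmoothPoincare4` (P = Sub)
set_option linter.dupNamespace false
set_option linter.style.longLine false

noncomputable section

open scoped Manifold ContDiff Topology
open Function Set Metric
open Literature.Topology.FourManifolds Literature.Topology.FourManifolds.MMSW

namespace Summit.SmoothPoincare4.SmoothPoincare4.Theorems.DcrGap.MkFriends

namespace FriendsTk

namespace EndDatum

variable {k : ℕ} (E : EndDatum k)

/-! ### Lower bounds for the size `N = e^{-σ}` near the core -/

/-- **Radial/tube lower bound**: at `incl y` off the core, `e^{-σ} ≥ ξ(α)`. [folklore] -/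
theorem ξ_le_exp_neg_collarInv_incl {Y : Type*} (jM : EuclideanSpace ℝ (Fin 4) → Y) (jB : ↥solidTorus → Y)
    {y : EuclideanSpace ℝ (Fin 4)} (hy : y ∈ E.hbNbhd) (h1 : 1 < levelFun k y) :
    TraceCollar.ξ (E.radA y) ≤ Real.exp (-(E.collarInv jM jB (E.incl y)).2) := by
  obtain ⟨hα, hα1⟩ := E.radA_mem_Ioo hy h1
  have hX : 0 < TraceCollar.ξ (E.radA y) := TraceCollar.ξ_pos hα hα1
  by_cases hc : E.dropA y ∈ E.closedTube
  · rw [E.collarInv_incl_of_mem jM jB hy hc, ΨTube]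
    simp only [neg_neg]
    have hΩ : (TraceCollar.ξ (E.radA y), Real.log (2 / ‖(E.ι₀ (E.dropA y)).2‖)) ∈ TraceCollar.Ωpos := hX
    have hN : 0 < (E.profP y).1 := (TraceCollar.Φ_mem_Quad hΩ).1
    rw [Real.exp_log hN, profP, TraceCollar.Φ, TraceCollar.Nf_of_pos hX]
    exact (le_max_left _ _).trans (TraceCollar.max_le_ρ hX _)
  · rw [E.collarInv_incl_of_not_mem jM jB hy h1 hc, ΨRad]
    simp only [neg_neg]
    rw [Real.exp_log hX]

/-- A handle-chart point `inr (x, w'')` off the core has `‖x‖ < 1` and `w'' ≠ 0`. [folklore] -/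
theorem norm_lt_one_of_inr_not_mem_trCore {x w : EuclideanSpace ℝ (Fin 2)} (hC : E.trGlueData.inr (x, w) ∉ E.trCore) :
    w ≠ 0 ∧ ‖x‖ < 1 := by
  rw [E.inr_mem_trCore_iff, not_or, not_le, not_and_or] at hC
  exact ⟨hC.2.resolve_right (not_not.2 hC.1.le), hC.1⟩

/-- **Flat lower bound**: at `inr (x, w'')` off the core, `e^{-σ} ≥ ψ(log (2/‖w‖))`, `w = univBall w''`. [folklore] -/
theorem ψ_le_exp_neg_collarInv_inr {Y : Type*} (jM : EuclideanSpace ℝ (Fin 4) → Y) (jB : ↥solidTorus → Y)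
    {x w : EuclideanSpace ℝ (Fin 2)} (hC : E.trGlueData.inr (x, w) ∉ E.trCore) :
    TraceCollar.ψ (Real.log (2 / ‖OpenPartialHomeomorph.univBall (0 : EuclideanSpace ℝ (Fin 2)) 2 w‖)) ≤
      Real.exp (-(E.collarInv jM jB (E.trGlueData.inr (x, w))).2) := by
  obtain ⟨hw, hx1⟩ := E.norm_lt_one_of_inr_not_mem_trCore hC
  have hw' : OpenPartialHomeomorph.univBall (0 : EuclideanSpace ℝ (Fin 2)) 2 w ≠ 0 := TubeNbhd.univBall_ne_zero hw
  have hr : 0 < ‖OpenPartialHomeomorph.univBall (0 : EuclideanSpace ℝ (Fin 2)) 2 w‖ := norm_pos_iff.2 hw'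
  have hYy : 0 < Real.log (2 / ‖OpenPartialHomeomorph.univBall (0 : EuclideanSpace ℝ (Fin 2)) 2 w‖) :=
    Real.log_pos ((lt_div_iff₀ hr).2 (by linarith [TubeNbhd.norm_univBall_lt w]))
  have hψ : 0 < TraceCollar.ψ (Real.log (2 / ‖OpenPartialHomeomorph.univBall (0 : EuclideanSpace ℝ (Fin 2)) 2 w‖)) := TraceCollar.ψ_pos hYy
  by_cases hx : x = 0
  · subst hx
    rw [E.collarInv_inr_zero, TubeNbhd.ΨFlat]
    simp only [neg_neg]
    rw [show TubeNbhd.radF ((0 : EuclideanSpace ℝ (Fin 2)), w) = ‖OpenPartialHomeomorph.univBall (0 : EuclideanSpace ℝ (Fin 2)) 2 w‖ from rfl,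
      Real.exp_log hψ]
  · have hx0 : (x, w).1 ≠ 0 := hx
    have hxpos : 0 < ‖x‖ := norm_pos_iff.2 hx
    have hy : E.bwd (x, w) = E.θ (E.collarTime ‖x‖, E.ν₀ (radialProjection (spherePt 1) x,
        OpenPartialHomeomorph.univBall (0 : EuclideanSpace ℝ (Fin 2)) 2 w)) := by
      conv_lhs => rw [← norm_smul_coe_radialProjection (spherePt 1) x]
      rw [E.bwd_smul hxpos, E.νK_eq]
    obtain ⟨hdrop, hrad, -⟩ := E.dropA_radA_ptA_arg (E.ν₀_mem (radialProjection (spherePt 1) x,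
      OpenPartialHomeomorph.univBall (0 : EuclideanSpace ℝ (Fin 2)) 2 w)) hxpos
    rw [← hy] at hdrop hrad
    have hmem : E.dropA (E.bwd (x, w)) ∈ E.closedTube := by
      rw [hdrop, mem_closedTube_iff]; exact (TubeNbhd.norm_univBall_lt w).le
    have hX : 0 < TraceCollar.ξ ‖x‖ := TraceCollar.ξ_pos hxpos hx1
    rw [E.inr_eq_incl_bwd hx0, E.collarInv_incl_of_mem jM jB (E.bwd_mem_hbNbhd hx0) hmem, ΨTube]
    simp only [neg_neg]
    rw [profP, hrad, hdrop, E.ι₀_ν₀]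
    have hΩ : (TraceCollar.ξ ‖x‖, Real.log (2 / ‖OpenPartialHomeomorph.univBall (0 : EuclideanSpace ℝ (Fin 2)) 2 w‖)) ∈ TraceCollar.Ωpos := hX
    have hN := (TraceCollar.Φ_mem_Quad hΩ).1
    rw [Real.exp_log hN, TraceCollar.Φ, TraceCollar.Nf_of_pos hX]
    exact (le_max_right _ _).trans (TraceCollar.max_le_ρ hX _)

/-! ### The closedness clause -/

namespace SmoothPresentation

variable {E} {Y : Type*} [TopologicalSpace Y] [ChartedSpace (EuclideanSpace ℝ (Fin 3)) Y] (P : E.SmoothPresentation Y)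

/-- **End clause 1**: `c(Y × [a, ∞))` is closed (the height `σ → -∞` exactly at the core). [folklore] -/
theorem isClosed_image_collar_ge (a : ℝ) : IsClosed (E.collar P.jM P.jB P.ψ '' {p | a ≤ p.2}) := by
  set α₀ : ℝ := TraceCollar.αof (Real.exp (-a)) with hα₀
  have hα₀pos : 0 < α₀ := TraceCollar.αof_pos (Real.exp_pos _)
  have hα₀1 : α₀ < 1 := TraceCollar.αof_lt_one _
  have hs₀ : 0 < E.collarTime α₀ := by
    by_contra h; push Not at h
    exact absurd ((E.collarTime_nonpos_iff hα₀pos.le).1 h) (not_le.2 hα₀1)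
  set Y₀ : ℝ := TraceCollar.ψinv (Real.exp (-a)) with hY₀
  have hY₀pos : 0 < Y₀ := TraceCollar.ψinv_pos _
  set U₁ : Set E.Trace := E.collar P.jM P.jB P.ψ '' {p | p.2 < a} with hU₁
  set U₂ : Set E.Trace := E.incl '' {y | y ∈ E.hbNbhd ∧ levelFun k y < 1 + E.collarTime α₀} with hU₂
  set U₃ : Set E.Trace := E.trGlueData.inr ''
    {z | ‖OpenPartialHomeomorph.univBall (0 : EuclideanSpace ℝ (Fin 2)) 2 z.2‖ < 2 * Real.exp (-Y₀)} with hU₃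
  have hO₁ : IsOpen U₁ := P.isOpen_image_collar (isOpen_lt continuous_snd continuous_const)
  have hO₂ : IsOpen U₂ := E.isOpen_image_incl (fun _ hy => hy.1)
    (((continuousOn_levelFun (r := k) (by norm_num : (0 : ℝ) < 1 / 2)).mono
      (fun y (hy : y ∈ E.hbNbhd) j => le_of_lt (hy.1 j))).isOpen_inter_preimage E.isOpen_hbNbhd isOpen_Iio)
  have hO₃ : IsOpen U₃ := by
    refine E.trGlueData.isOpenEmbedding_inr.isOpenMap _ (isOpen_lt ?_ continuous_const)
    exact continuous_norm.comp ((OpenPartialHomeomorph.contDiff_univBall (n := ⊤) (c := (0 : EuclideanSpace ℝ (Fin 2))) (r := 2)).continuous.comp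
      continuous_snd)
  -- points of these pieces have height `< a` (or are in the core)
  have hlow : ∀ z ∈ U₁ ∪ U₂ ∪ U₃, z ∉ E.collar P.jM P.jB P.ψ '' {p | a ≤ p.2} := by
    rintro z hz ⟨p, hp, rfl⟩
    have hσ : (E.collarInv P.jM P.jB (E.collar P.jM P.jB P.ψ p)).2 = p.2 := by rw [P.collarInv_collar]
    have hC : E.collar P.jM P.jB P.ψ p ∉ E.trCore := P.collar_not_mem_trCore p
    rcases hz with (⟨p', hp', hpp'⟩ | ⟨y, ⟨hy, hyG⟩, hyp⟩) | ⟨z', hz', hzp⟩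
    · rw [P.collar_injective hpp'] at hp'
      exact (not_lt.2 hp) (show p.2 < a from hp')
    · rw [← hyp] at hσ hC
      -- `y` is off `D_k`: `1 < G_k y`
      have h1 : 1 < levelFun k y := by
        by_contra hle; push Not at hle
        exact hC ((E.incl_mem_trCore_iff hy).2 (Or.inl ⟨fun j => one_le_holeTerm_of_levelFun_le_one
          (fun j => lt_trans (by norm_num) (hy.1 j)) hle j, hle⟩))
      obtain ⟨hα, hα1⟩ := E.radA_mem_Ioo hy h1
      have hbound := E.ξ_le_exp_neg_collarInv_incl P.jM P.jB hy h1
      rw [hσ] at hbound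
      have hrad : α₀ < E.radA y := by
        rw [← E.collarTime_lt_collarTime_iff hα.le hα₀pos.le, E.collarTime_radA hy h1]; linarith
      have hξ : Real.exp (-a) < TraceCollar.ξ (E.radA y) := by
        rw [← TraceCollar.ξ_αof (Real.exp (-a))]
        exact TubeNbhd.ξ_lt_ξ hα₀pos.le hrad hα1
      exact (not_lt.2 hp) (TubeNbhd.lt_of_exp_neg_lt (hξ.trans_le hbound))
    · obtain ⟨x, w⟩ := z'
      rw [← hzp] at hσ hC
      have hbound := E.ψ_le_exp_neg_collarInv_inr P.jM P.jB hC
      rw [hσ] at hbound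
      obtain ⟨hw, -⟩ := E.norm_lt_one_of_inr_not_mem_trCore hC
      have hr : 0 < ‖OpenPartialHomeomorph.univBall (0 : EuclideanSpace ℝ (Fin 2)) 2 w‖ := norm_pos_iff.2 (TubeNbhd.univBall_ne_zero hw)
      simp only [mem_setOf_eq] at hz'
      have hYy : Y₀ < Real.log (2 / ‖OpenPartialHomeomorph.univBall (0 : EuclideanSpace ℝ (Fin 2)) 2 w‖) := by
        rw [Real.lt_log_iff_exp_lt (by positivity), lt_div_iff₀ hr]
        have := hz'
        rw [Real.exp_neg] at this
        calc Real.exp Y₀ * ‖OpenPartialHomeomorph.univBall (0 : EuclideanSpace ℝ (Fin 2)) 2 w‖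
            < Real.exp Y₀ * (2 * (Real.exp Y₀)⁻¹) := by gcongr
          _ = 2 := by field_simp
      have hψ : Real.exp (-a) < TraceCollar.ψ (Real.log (2 / ‖OpenPartialHomeomorph.univBall (0 : EuclideanSpace ℝ (Fin 2)) 2 w‖)) := by
        rw [← TraceCollar.ψ_ψinv (Real.exp_pos (-a))]
        exact TraceCollar.strictMonoOn_ψ hY₀pos.le (hY₀pos.trans hYy).le hYy
      exact (not_lt.2 hp) (TubeNbhd.lt_of_exp_neg_lt (hψ.trans_le hbound))
  -- the complement is the union of the three pieces
  have heq : (E.collar P.jM P.jB P.ψ '' {p | a ≤ p.2})ᶜ = U₁ ∪ U₂ ∪ U₃ := by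
    refine Subset.antisymm ?_ fun z hz => hlow z hz
    intro z hz
    by_cases hC : z ∈ E.trCore
    · rcases hC with ⟨y, hy, rfl⟩ | ⟨x, hx, rfl⟩
      · refine Or.inl (Or.inr ⟨y, ⟨E.modelHandlebody_subset_hbNbhd hy, ?_⟩, rfl⟩)
        linarith [hy.2]
      · refine Or.inr ⟨(x, 0), ?_, rfl⟩
        simp only [mem_setOf_eq, OpenPartialHomeomorph.univBall_apply_zero, norm_zero]
        positivity
    · obtain ⟨p, rfl⟩ : z ∈ range (E.collar P.jM P.jB P.ψ) := by rw [P.range_collar]; exact hC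
      refine Or.inl (Or.inl ⟨p, ?_, rfl⟩)
      simp only [mem_setOf_eq]
      by_contra h
      exact hz ⟨p, not_lt.1 h, rfl⟩
  rw [← isOpen_compl_iff, heq]
  exact (hO₁.union hO₂).union hO₃

end SmoothPresentation

end EndDatum

end FriendsTk

/-- **Helper `helper_friendsCarrier_Tk_endClosed`** (registered on the crux item; end collar part 8 of
stub `helper_friendsCarrier_Tk`): under the hypotheses of `helper_friendsCarrier_Tk`, the end collar `c` of
the relative open trace is injective and `c(Y × [a, ∞))` is closed in `T` for every `a` (the collar height
tends to `-∞` exactly at the core; Kirby 1989, Ch. I §5). [cite: Kirby1989, Ch. I §5] -/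
theorem helper_friendsCarrier_Tk_endClosed : ∀ (k : ℕ) (K₀ : (sphere (0 : EuclideanSpace ℝ (Fin 2)) 1) → EuclideanSpace ℝ (Fin 4)), IsModelKnot k K₀ → ∀ (Y : Type) [TopologicalSpace Y] [T2Space Y] [SecondCountableTopology Y] [ChartedSpace (EuclideanSpace ℝ (Fin 3)) Y] [IsManifold (𝓡 3) ∞ Y] (jB : solidTorus → Y) (μ₀ : C((sphere (0 : EuclideanSpace ℝ (Fin 2)) 1), Y)) (νK : (sphere (0 : EuclideanSpace ℝ (Fin 2)) 1) × EuclideanSpace ℝ (Fin 2) → EuclideanSpace ℝ (Fin 4)) (jM : EuclideanSpace ℝ (Fin 4) → Y) (W : Set (EuclideanSpace ℝ (Fin 4))) (ψ : Y → EuclideanSpace ℝ (Fin 4)), (Manifold.IsSmoothEmbedding (𝓘(ℝ, EuclideanSpace ℝ (Fin 2)).prod (𝓡 1)) (𝓡 3) ∞ jB ∧ IsOpen (range jB) ∧ ContMDiff ((𝓡 1).prod 𝓘(ℝ, EuclideanSpace ℝ (Fin 2))) 𝓘(ℝ, EuclideanSpace ℝ (Fin 4)) ∞ νK ∧ Injective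 νK ∧ (∀ p, Injective (mfderiv ((𝓡 1).prod 𝓘(ℝ, EuclideanSpace ℝ (Fin 2))) 𝓘(ℝ, EuclideanSpace ℝ (Fin 4)) νK p)) ∧ (∀ p, νK p ∈ modelBoundary k) ∧ (∀ u : (sphere (0 : EuclideanSpace ℝ (Fin 2)) 1), νK (u, 0) = K₀ u) ∧ IsOpen W ∧ (∀ x ∈ modelBoundary k, x ∉ range K₀ → x ∈ W) ∧ ContMDiffOn 𝓘(ℝ, EuclideanSpace ℝ (Fin 4)) (𝓡 3) ∞ jM W ∧ IsOpen (jM '' {x : EuclideanSpace ℝ (Fin 4) | x ∈ modelBoundary k ∧ x ∉ range K₀}) ∧ ContMDiffOn (𝓡 3) 𝓘(ℝ, EuclideanSpace ℝ (Fin 4)) ∞ ψ (jM '' {x : EuclideanSpace ℝ (Fin 4) | x ∈ modelBoundary k ∧ x ∉ range K₀}) ∧ (∀ x ∈ modelBoundary k, x ∉ range K₀ → ψ (jM x) = x) ∧ jM '' {x : EuclideanSpace ℝ (Fin 4) | x ∈ modelBoundary k ∧ x ∉ range K₀} ∪ range jB = univ ∧ (∀ x ∈ modelBoundary k, x ∉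 range K₀ → ∀ b : solidTorus, jM x = jB b ↔ ∃ (u : (sphere (0 : EuclideanSpace ℝ (Fin 2)) 1)) (t : ℝ), t ∈ Ioo (0 : ℝ) 1 ∧ b.1.1 = t • (u : EuclideanSpace ℝ (Fin 2)) ∧ x = νK (u, t • (b.1.2 : EuclideanSpace ℝ (Fin 2))))) → ∃ (X : Type) (_ : TopologicalSpace X) (_ : T2Space X) (_ : ChartedSpace (EuclideanSpace ℝ (Fin 4)) X) (_ : IsManifold (𝓡 4) ∞ X) (c : Y × ℝ → X), Injective c ∧ (∀ a : ℝ, IsClosed (c '' {p | a ≤ p.2})) := by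
  intro k K₀ _ Y _ _ _ _ _ jB μ₀ νK jM W ψ ⟨h1, h2, h3, h4, h5, h6, h7, h8, h9, h10, h11, h12, h13, h14, h15⟩
  let E : FriendsTk.EndDatum k := FriendsTk.EndDatum.endDatumOf h3 h4 h5 h6 h7
  let P : E.SmoothPresentation Y := FriendsTk.EndDatum.smoothPresentationOf h3 h4 h5 h6 h7 h1 h2 h8 h9 h10 h11 h12 h13 h14 h15
  exact ⟨E.Trace, inferInstance, inferInstance, inferInstance, inferInstance, E.collar P.jM P.jB P.ψ, P.collar_injective,
    P.isClosed_image_collar_ge⟩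

end Summit.SmoothPoincare4.SmoothPoincare4.Theorems.DcrGap.MkFriends

end
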